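import Mathlib
import Summits.Ventures.PercRepro2.A3CutFMoTerms
import Summits.Ventures.PercRepro2.A3CutGc

/-!
# The explored vertex is a cut vertex with the mark `b` behind it: `btw` and `FMfun` are
`P(b ↔ x)` times their values at the mark `b = x`
(blind cell PercRepro2, night-1 g33; proofs/NIGHT1-G33.md §6)

Setting of A3CutFMoFibres with the roles of `o` and `b` exchanged: `x` a cut vertex
(`IsCut ends x ↑VA ↑VB EA EB`), the mark `b ∈ VA` behind it, `o, a₁, a₂ ∈ VB ∪ {x}`.  On every fibre of
the `x`-exploration `Sb = [b ∈ W] · s3 · m_W` (`Ssig_o_x_eq` with `o := b`), i.e. the `b`-masses are the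
masses restricted to the `A`-side event `{b ↔_A x}` (`mZ_bx`, `SsigZ_bx`, `SuZ_bx`), so by the scaling
lemma `sum_fibre_x_scale` every `b`-weighted fibre sum is `P(b ↔ x)` times the sum with `b := x`
(`sum_term_bA`, `sum_Ssig_bA`); the `A`-parts vanish and `P(Q, b ∈ U) = P(b ↔ x) · P(Q, x ∈ U)`
(`mU_bA`).  Hence **`btw(x; b) = P(b ↔ x) · btw(x; x)`** (`btw_cut_bBehind`) and
**`FMfun(x; b) = P(b ↔ x) · FMfun(x; x)`** (`FMfun_cut_bBehind`), and (MEANS-a₃), (FM), (HCOV) at `x`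
follow from the self-mark theorems `A3Between_self_b`, `FM_self_b` (`A3Between_cut_bBehind`,
`FM_cut_bBehind`, `HCov_cut_bBehind`).  Standard axioms.
-/

namespace Summit.Ventures.PercRepro2

open UnionCluster CovForm CutV

namespace CovForm

namespace A3Fibre

namespace CutBBehind

section BBehind

variable {V : Type*} {E : Type*} [Fintype V] [DecidableEq V] [Fintype E] [DecidableEq E]
  {R : Type*} [Field R] [LinearOrder R] [IsStrictOrderedRing R] {ends : E → Sym2 V} {x : V}
  {VA VB : Finset V} {EA EB : Set E} [DecidablePred (· ∈ EA)] [DecidablePred (· ∈ EB)] {p : E → R}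
  {o a₁ a₂ b : V}

/-! ## The `b`-masses are the masses restricted to `{b ↔_A x}` -/

omit [Fintype V] [DecidableEq V] [Fintype E] [DecidableEq E] [Field R] [LinearOrder R]
  [IsStrictOrderedRing R] [DecidablePred (· ∈ EB)] in
/-- On a fibre of `x` containing `b`, the `A`-side event `{b ↔_A x}` holds. -/
lemma fibre_inter_bx_of_mem (h : IsCut ends x ↑VA ↑VB EA EB) (hb : b ∈ VA) (a₁ a₂ : V)
    {W : Finset V} (hW : b ∈ W) :
    fibre ends a₁ a₂ x W ∩ sideEvent EA (connEvent ends b x) = fibre ends a₁ a₂ x W := by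
  refine Set.inter_eq_left.2 fun ω hω => ?_
  rw [mem_sideEvent, mem_connEvent, ← conn_iff_restrict h (Or.inl (Finset.mem_coe.2 hb)) (Or.inr rfl)]
  apply conn_symm
  have : b ∈ cluster ends ω x := by rw [hω.2]; exact Finset.mem_coe.2 hW
  exact this

omit [Fintype V] [DecidableEq V] [Fintype E] [DecidableEq E] [Field R] [LinearOrder R]
  [IsStrictOrderedRing R] [DecidablePred (· ∈ EB)] in
/-- On a fibre of `x` not containing `b`, the `A`-side event `{b ↔_A x}` fails. -/
lemma fibre_inter_bx_of_notMem (h : IsCut ends x ↑VA ↑VB EA EB) (hb : b ∈ VA) (a₁ a₂ : V)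
    {W : Finset V} (hW : b ∉ W) :
    fibre ends a₁ a₂ x W ∩ sideEvent EA (connEvent ends b x) = ∅ := by
  ext ω
  simp only [Set.mem_inter_iff, mem_sideEvent, mem_connEvent, Set.mem_empty_iff_false, iff_false,
    not_and]
  intro hω hc
  apply hW
  have : b ∈ cluster ends ω x :=
    conn_symm ((conn_iff_restrict h (Or.inl (Finset.mem_coe.2 hb)) (Or.inr rfl)).2 hc)
  rw [hω.2] at this
  exact Finset.mem_coe.1 this

omit [Fintype V] [LinearOrder R] [IsStrictOrderedRing R] [DecidablePred (· ∈ EB)] in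
/-- `mZ` on `{b ↔_A x}`. -/
lemma mZ_bx (h : IsCut ends x ↑VA ↑VB EA EB) (hb : b ∈ VA) (a₁ a₂ : V) (W : Finset V) :
    mZ p ends a₁ a₂ x (sideEvent EA (connEvent ends b x)) W =
      (if b ∈ W then 1 else 0) * mW p ends a₁ a₂ x W := by
  unfold mZ mW
  by_cases hW : b ∈ W
  · rw [if_pos hW, one_mul, fibre_inter_bx_of_mem h hb a₁ a₂ hW]
  · rw [if_neg hW, zero_mul, fibre_inter_bx_of_notMem h hb a₁ a₂ hW, prob_empty]

omit [Fintype V] [LinearOrder R] [IsStrictOrderedRing R] [DecidablePred (· ∈ EB)] in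
/-- `SsigZ` on `{b ↔_A x}`. -/
lemma SsigZ_bx (h : IsCut ends x ↑VA ↑VB EA EB) (hb : b ∈ VA) (a₁ a₂ y : V) (W : Finset V) :
    SsigZ p ends a₁ a₂ x y (sideEvent EA (connEvent ends b x)) W =
      (if b ∈ W then 1 else 0) * Ssig p ends a₁ a₂ x y W := by
  unfold SsigZ Ssig
  by_cases hW : b ∈ W
  · rw [if_pos hW, one_mul, fibre_inter_bx_of_mem h hb a₁ a₂ hW]
  · rw [if_neg hW, zero_mul, fibre_inter_bx_of_notMem h hb a₁ a₂ hW, Set.empty_inter,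
      Set.empty_inter, prob_empty, sub_zero]

omit [Fintype V] [LinearOrder R] [IsStrictOrderedRing R] [DecidablePred (· ∈ EB)] in
/-- `SuZ` on `{b ↔_A x}`. -/
lemma SuZ_bx (h : IsCut ends x ↑VA ↑VB EA EB) (hb : b ∈ VA) (a₁ a₂ y : V) (W : Finset V) :
    SuZ p ends a₁ a₂ x y (sideEvent EA (connEvent ends b x)) W =
      (if b ∈ W then 1 else 0) * Su p ends a₁ a₂ x y W := by
  unfold SuZ Su
  by_cases hW : b ∈ W
  · rw [if_pos hW, one_mul, fibre_inter_bx_of_mem h hb a₁ a₂ hW]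
  · rw [if_neg hW, zero_mul, fibre_inter_bx_of_notMem h hb a₁ a₂ hW, Set.empty_inter,
      Set.empty_inter, prob_empty, add_zero]

omit [Fintype V] [DecidableEq V] [Fintype E] [DecidableEq E] [Field R] [LinearOrder R]
  [IsStrictOrderedRing R] [DecidablePred (· ∈ EB)] in
/-- `{b ↔ x}` is an `A`-side event. -/
lemma connEvent_bx_eq (h : IsCut ends x ↑VA ↑VB EA EB) (hb : b ∈ VA) :
    connEvent ends b x = sideEvent EA (connEvent ends b x) :=
  connEvent_eq_sideEvent h (Or.inl (Finset.mem_coe.2 hb)) (Or.inr rfl)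

/-! ## The scaled sums -/

omit [LinearOrder R] [IsStrictOrderedRing R] in
/-- `∑_W s3 · SFg(γ)` restricted to `{b ↔ x}` is `P(b ↔ x) · ∑_W s3 · SFg(γ)`. -/
lemma sum_s3_SFg_bA (h : IsCut ends x ↑VA ↑VB EA EB) (hb : b ∈ VA) (ho : o ∈ insert x VB)
    (h1 : a₁ ∈ insert x VB) (h2 : a₂ ∈ insert x VB) (γ : R) :
    ∑ W : Finset V, (if b ∈ W then 1 else 0) * (s3 a₁ a₂ W * RootEdge.SFg p ends o a₁ a₂ x γ W) =
      prob p (connEvent ends b x) * ∑ W : Finset V, s3 a₁ a₂ W * RootEdge.SFg p ends o a₁ a₂ x γ W := by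
  have key := sum_fibre_x_scale (p := p) h ho h1 h2 (Finset.mem_insert_self x VB) (connEvent ends b x)
    (fun W m _ so _ uo => s3 a₁ a₂ W * (so + s3 a₁ a₂ W * (γ * m - uo)))
    (fun W => by ring)
    (fun W c m sb so ub uo => by ring)
    (fun S hS W => by
      funext m sb so ub uo
      rw [s3_union_left (fun hc => notMem_VA_of_mem_VB h h1 (hS hc))
        (fun hc => notMem_VA_of_mem_VB h h2 (hS hc))])
  simp only [mZ_bx h hb, SsigZ_bx h hb, SuZ_bx h hb] at key
  unfold RootEdge.SFg
  rw [connEvent_bx_eq h hb, ← key]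
  refine Finset.sum_congr rfl fun W _ => ?_
  ring

omit [LinearOrder R] [IsStrictOrderedRing R] in
/-- `∑_W s3 · m_W` restricted to `{b ↔ x}` is `P(b ↔ x) · ∑_W s3 · m_W`. -/
lemma sum_s3_mW_bA (h : IsCut ends x ↑VA ↑VB EA EB) (hb : b ∈ VA) (ho : o ∈ insert x VB)
    (h1 : a₁ ∈ insert x VB) (h2 : a₂ ∈ insert x VB) :
    ∑ W : Finset V, (if b ∈ W then 1 else 0) * (s3 a₁ a₂ W * mW p ends a₁ a₂ x W) =
      prob p (connEvent ends b x) * ∑ W : Finset V, s3 a₁ a₂ W * mW p ends a₁ a₂ x W := by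
  have key := sum_fibre_x_scale (p := p) h ho h1 h2 (Finset.mem_insert_self x VB) (connEvent ends b x)
    (fun W m _ _ _ _ => s3 a₁ a₂ W * m)
    (fun W => by ring)
    (fun W c m sb so ub uo => by ring)
    (fun S hS W => by
      funext m sb so ub uo
      rw [s3_union_left (fun hc => notMem_VA_of_mem_VB h h1 (hS hc))
        (fun hc => notMem_VA_of_mem_VB h h2 (hS hc))])
  simp only [mZ_bx h hb] at key
  rw [connEvent_bx_eq h hb, ← key]
  refine Finset.sum_congr rfl fun W _ => ?_
  ring

/-- The ratio sum with `b` behind `x`: `∑_W Sb · SFg(γ) / m_W = P(b ↔ x) · ∑_W s3 · SFg(γ)`. -/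
lemma sum_term_bA (hp : IsProbVec p) (h : IsCut ends x ↑VA ↑VB EA EB) (hb : b ∈ VA)
    (ho : o ∈ insert x VB) (h1 : a₁ ∈ insert x VB) (h2 : a₂ ∈ insert x VB) (γ : R) :
    ∑ W : Finset V, Ssig p ends a₁ a₂ x b W * RootEdge.SFg p ends o a₁ a₂ x γ W /
        mW p ends a₁ a₂ x W =
      prob p (connEvent ends b x) * ∑ W : Finset V, s3 a₁ a₂ W * RootEdge.SFg p ends o a₁ a₂ x γ W := by
  rw [← sum_s3_SFg_bA h hb ho h1 h2 γ]
  refine Finset.sum_congr rfl fun W _ => ?_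
  rw [Ssig_o_x_eq (o := b) h hb h1 h2]
  by_cases hm : mW p ends a₁ a₂ x W = 0
  · have hs := Ssig_eq_zero_of_mW_eq_zero hp ends a₁ a₂ x o W hm
    have hu := Su_eq_zero_of_mW_eq_zero hp ends a₁ a₂ x o W hm
    unfold RootEdge.SFg
    rw [hm, hs, hu]
    simp
  · field_simp

omit [LinearOrder R] [IsStrictOrderedRing R] in
/-- The `σ_b`-sum with `b` behind `x`: `∑_W Sb = P(b ↔ x) · ∑_W s3 · m_W`. -/
lemma sum_Ssig_bA (h : IsCut ends x ↑VA ↑VB EA EB) (hb : b ∈ VA) (ho : o ∈ insert x VB)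
    (h1 : a₁ ∈ insert x VB) (h2 : a₂ ∈ insert x VB) :
    ∑ W : Finset V, Ssig p ends a₁ a₂ x b W =
      prob p (connEvent ends b x) * ∑ W : Finset V, s3 a₁ a₂ W * mW p ends a₁ a₂ x W := by
  rw [← sum_s3_mW_bA h hb ho h1 h2]
  refine Finset.sum_congr rfl fun W _ => ?_
  rw [Ssig_o_x_eq (o := b) h hb h1 h2]

omit [LinearOrder R] [IsStrictOrderedRing R] [DecidablePred (· ∈ EB)] in
/-- `∑_{W ∈ A} Su_b W = 0` with `b` behind `x`. -/
lemma sum_SuA_bA (h : IsCut ends x ↑VA ↑VB EA EB) (hb : b ∈ VA) (h1 : a₁ ∈ insert x VB)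
    (h2 : a₂ ∈ insert x VB) : ∑ W ∈ fibresA a₁ a₂, Su p ends a₁ a₂ x b W = 0 := by
  rw [fibresA, Finset.sum_filter]
  exact Finset.sum_eq_zero fun W _ => SuA_o_x_oA (o := b) h hb h1 h2 W

omit [LinearOrder R] [IsStrictOrderedRing R] [DecidablePred (· ∈ EB)] in
/-- `∑_{W ∈ A} Su_b · Su_o / m_W = 0` with `b` behind `x`. -/
lemma sum_termA_bA (h : IsCut ends x ↑VA ↑VB EA EB) (hb : b ∈ VA) (h1 : a₁ ∈ insert x VB)
    (h2 : a₂ ∈ insert x VB) :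
    ∑ W ∈ fibresA a₁ a₂, Su p ends a₁ a₂ x b W * Su p ends a₁ a₂ x o W / mW p ends a₁ a₂ x W =
      0 := by
  refine Finset.sum_eq_zero fun W hW => ?_
  rw [fibresA, Finset.mem_filter] at hW
  rw [Su_o_x_eq (o := b) h hb h1 h2, s3_eq_zero_of_notMem hW.2.1 hW.2.2]
  simp

omit [Fintype V] [LinearOrder R] [IsStrictOrderedRing R] in
/-- `P(Q, b ∈ U) = P(b ↔ x) · P(Q, x ∈ U)` with `b` behind `x`. -/
lemma mU_bA (h : IsCut ends x ↑VA ↑VB EA EB) (hb : b ∈ VA) (h1 : a₁ ∈ insert x VB)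
    (h2 : a₂ ∈ insert x VB) :
    LeafStep.mU p ends a₁ a₂ b = prob p (connEvent ends b x) * LeafStep.mU p ends a₁ a₂ x := by
  have hX : (Set.univ : Set (Config E)) = sideEvent EB Set.univ := by
    ext ω; simp [mem_sideEvent]
  have k1 := prob_Q_conn_v_inter (p := p) h hb h1 h1 h2 Set.univ hX
  have k2 := prob_Q_conn_v_inter (p := p) h hb h2 h1 h2 Set.univ hX
  simp only [Set.inter_univ] at k1 k2
  unfold LeafStep.mU
  rw [k1, k2]
  ring

/-! ## The self-mark forms -/

omit [Fintype V] [LinearOrder R] [IsStrictOrderedRing R] [DecidablePred (· ∈ EA)]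
  [DecidablePred (· ∈ EB)] in
/-- `Ssig_x` on the fibres of `x`: `s3 · m_W`. -/
lemma Ssig_self_x (ends : E → Sym2 V) (a₁ a₂ x : V) (W : Finset V) :
    Ssig p ends a₁ a₂ x x W = s3 a₁ a₂ W * mW p ends a₁ a₂ x W := by
  by_cases hx : x ∈ W
  · exact Ssig_eq_of_mem p ends a₁ a₂ x x W hx
  · have he := fibre_eq_empty_of_notMem_self ends a₁ a₂ x hx
    unfold Ssig mW
    rw [he]
    simp

omit [Fintype V] [LinearOrder R] [IsStrictOrderedRing R] [DecidablePred (· ∈ EA)]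
  [DecidablePred (· ∈ EB)] in
/-- `Su_x` on the fibres of `x`: `s3² · m_W`. -/
lemma Su_self_x (ends : E → Sym2 V) (a₁ a₂ x : V) (W : Finset V) :
    Su p ends a₁ a₂ x x W = s3 a₁ a₂ W ^ 2 * mW p ends a₁ a₂ x W := by
  by_cases hx : x ∈ W
  · exact Su_eq_of_mem p ends a₁ a₂ x x W hx
  · have he := fibre_eq_empty_of_notMem_self ends a₁ a₂ x hx
    unfold Su mW
    rw [he]
    simp

omit [DecidablePred (· ∈ EA)] [DecidablePred (· ∈ EB)] in
/-- The ratio sum at the mark `b = x`. -/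
lemma sum_term_self_x (hp : IsProbVec p) (ends : E → Sym2 V) (o a₁ a₂ x : V) (γ : R) :
    ∑ W : Finset V, Ssig p ends a₁ a₂ x x W * RootEdge.SFg p ends o a₁ a₂ x γ W /
        mW p ends a₁ a₂ x W =
      ∑ W : Finset V, s3 a₁ a₂ W * RootEdge.SFg p ends o a₁ a₂ x γ W := by
  refine Finset.sum_congr rfl fun W _ => ?_
  rw [Ssig_self_x]
  by_cases hm : mW p ends a₁ a₂ x W = 0
  · have hs := Ssig_eq_zero_of_mW_eq_zero hp ends a₁ a₂ x o W hm
    have hu := Su_eq_zero_of_mW_eq_zero hp ends a₁ a₂ x o W hm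
    unfold RootEdge.SFg
    rw [hm, hs, hu]
    simp
  · field_simp

omit [LinearOrder R] [IsStrictOrderedRing R] [DecidablePred (· ∈ EA)] [DecidablePred (· ∈ EB)] in
/-- `∑_W Ssig_x W = ∑_W s3 · m_W`. -/
lemma sum_Ssig_self_x (ends : E → Sym2 V) (a₁ a₂ x : V) :
    ∑ W : Finset V, Ssig p ends a₁ a₂ x x W = ∑ W : Finset V, s3 a₁ a₂ W * mW p ends a₁ a₂ x W :=
  Finset.sum_congr rfl fun W _ => Ssig_self_x ends a₁ a₂ x W

omit [LinearOrder R] [IsStrictOrderedRing R] [DecidablePred (· ∈ EA)] [DecidablePred (· ∈ EB)] in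
/-- `∑_{W ∈ A} Su_x W = 0`. -/
lemma sum_SuA_self_x (ends : E → Sym2 V) (a₁ a₂ x : V) :
    ∑ W ∈ fibresA a₁ a₂, Su p ends a₁ a₂ x x W = 0 := by
  refine Finset.sum_eq_zero fun W hW => ?_
  rw [fibresA, Finset.mem_filter] at hW
  rw [Su_self_x, s3_eq_zero_of_notMem hW.2.1 hW.2.2]
  ring

omit [LinearOrder R] [IsStrictOrderedRing R] [DecidablePred (· ∈ EA)] [DecidablePred (· ∈ EB)] in
/-- `∑_{W ∈ A} Su_x · Su_o / m_W = 0`. -/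
lemma sum_termA_self_x (ends : E → Sym2 V) (o a₁ a₂ x : V) :
    ∑ W ∈ fibresA a₁ a₂, Su p ends a₁ a₂ x x W * Su p ends a₁ a₂ x o W / mW p ends a₁ a₂ x W =
      0 := by
  refine Finset.sum_eq_zero fun W hW => ?_
  rw [fibresA, Finset.mem_filter] at hW
  rw [Su_self_x, s3_eq_zero_of_notMem hW.2.1 hW.2.2]
  simp

/-! ## The reductions -/

/-- **`btw(x; b) = P(b ↔ x) · btw(x; x)`** with `b` behind the explored cut vertex `x`. -/
theorem btw_cut_bBehind (hp : IsProbVec p) (h : IsCut ends x ↑VA ↑VB EA EB) (hb : b ∈ VA)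
    (ho : o ∈ insert x VB) (h1 : a₁ ∈ insert x VB) (h2 : a₂ ∈ insert x VB) :
    btw p ends o a₁ a₂ x b = prob p (connEvent ends b x) * btw p ends o a₁ a₂ x x := by
  rw [← RootEdge.btwg_gamma, ← RootEdge.btwg_gamma]
  unfold RootEdge.btwg
  rw [sum_term_bA hp h hb ho h1 h2, sum_Ssig_bA h hb ho h1 h2, sum_termA_bA h hb h1 h2,
    sum_SuA_bA h hb h1 h2, sum_term_self_x hp ends o a₁ a₂ x, sum_Ssig_self_x ends a₁ a₂ x,
    sum_termA_self_x ends o a₁ a₂ x, sum_SuA_self_x ends a₁ a₂ x]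
  ring

/-- **`FMfun(x; b) = P(b ↔ x) · FMfun(x; x)`** with `b` behind the explored cut vertex `x`. -/
theorem FMfun_cut_bBehind (hp : IsProbVec p) (h : IsCut ends x ↑VA ↑VB EA EB) (hb : b ∈ VA)
    (ho : o ∈ insert x VB) (h1 : a₁ ∈ insert x VB) (h2 : a₂ ∈ insert x VB) :
    FMfun p ends o a₁ a₂ x b = prob p (connEvent ends b x) * FMfun p ends o a₁ a₂ x x := by
  unfold FMfun
  rw [sum_term_bA hp h hb ho h1 h2, sum_Ssig_bA h hb ho h1 h2, sum_termA_bA h hb h1 h2,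
    sum_SuA_bA h hb h1 h2, sum_term_self_x hp ends o a₁ a₂ x, sum_Ssig_self_x ends a₁ a₂ x,
    sum_termA_self_x ends o a₁ a₂ x, sum_SuA_self_x ends a₁ a₂ x, mU_bA h hb h1 h2]
  ring

/-- (MEANS-a₃) at `x` with `b` behind it, from the self-mark theorem. -/
theorem A3Between_cut_bBehind (hp : IsProbVec p) (h : IsCut ends x ↑VA ↑VB EA EB) (hb : b ∈ VA)
    (ho : o ∈ insert x VB) (h1 : a₁ ∈ insert x VB) (h2 : a₂ ∈ insert x VB) :
    A3Between p ends o a₁ a₂ x b := by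
  unfold A3Between
  rw [btw_cut_bBehind hp h hb ho h1 h2]
  exact mul_nonneg (prob_nonneg hp _) (A3Between_self_b hp ends o a₁ a₂ x)

/-- (FM) at `x` with `b` behind it, from the self-mark theorem. -/
theorem FM_cut_bBehind (hp : IsProbVec p) (h : IsCut ends x ↑VA ↑VB EA EB) (hb : b ∈ VA)
    (ho : o ∈ insert x VB) (h1 : a₁ ∈ insert x VB) (h2 : a₂ ∈ insert x VB) :
    FM p ends o a₁ a₂ x b := by
  unfold FM
  rw [FMfun_cut_bBehind hp h hb ho h1 h2]
  exact mul_nonneg (prob_nonneg hp _) (FM_self_b hp ends o a₁ a₂ x)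

/-- (HCOV) at `x` with `b` behind it. -/
theorem HCov_cut_bBehind (hp : IsProbVec p) (h : IsCut ends x ↑VA ↑VB EA EB) (hb : b ∈ VA)
    (ho : o ∈ insert x VB) (h1 : a₁ ∈ insert x VB) (h2 : a₂ ∈ insert x VB) :
    HCov p ends o a₁ a₂ x b :=
  HCov_of_a3Between hp ends o a₁ a₂ x b (A3Between_cut_bBehind hp h hb ho h1 h2)

end BBehind

end CutBBehind

end A3Fibre

end CovForm

end Summit.Ventures.PercRepro2
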